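import Mathlib
import HarnessLib
import Summits.HubbardSuperconductivity.HubbardSuperconductivity.Theorems.KLProgrammeKLRegimeEngineLastStepAliasArith

/-!
# K3 gen-8-FLOW (stmt 20437, stub (C), located item #20, cure (δ′) «LAST-STEP SWAP», layer F3g″): THE LAST-STEP ALIAS ROWS IN ABSTRACT VARIABLES —
# alias part, far part and the numeric assembly of `AL_X j`, channels `a` (datum `1`) and `b`/`c` (moment data)

Cell gate-hubbard-kl, seat p2 g20 («(δ′)-ALIAS-ROWS», step 2).  The alias rows of `lastResponse_bracket_flow_sharp_env` (p632839) read, at `Mg = 26`,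
`AL_a j ≥ 2(2(1·(3ʲ·Dg_a·(2/N)^{22−j}·S))) + L²Lʲ·(A₀_a·(1/(1+L/4)^s))` and `AL_b j ≥ 2(2(Mm_b j·(3ʲ·Dg_b·(2/N)^{22−j}·S))) + L²Lʲ·(A₀_b·(Ms_b/(1+L/4)^s))`
(`S = 2²Σ'_{k∈ℤ²}Π(1+kᵢ²)⁻¹ ≤ 81`), with `Dg_a = P_a(26!)²ρ₃²⁶`, `A₀_a = P_a`, `Dg_b = P_b²(26!)²ρ₄²⁶ + 2P_b(26!)²ρ₃²⁶`, `A₀_b = P_b² + 2P_b`.  Here every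
piece is bounded in ABSTRACT variables (the literal instantiation is the next file):

* §1 `aliasPartA_le` (`≤ (26244/64)·Q`), `aliasPartB_le` (`≤ Mm·(1869885·Q)`) from `ρ·r ≤ ε`, `ρ ≤ B`, `(26!)²B⁸ε¹⁸ ≤ Q`, `P_a ≤ 1/64`, `P_b ≤ 15/2`, `S ≤ 81`;
  nonnegativity `aliasPartA_nonneg`, `aliasPartB_nonneg`;
* §2 `farPartA_le` (`≤ (1/64)·4⁶·X⁴`), `farPartB_le` (`≤ Ms·((285/4)·4⁶·X⁴)`) for `4/L ≤ X ≤ 1`, `10 ≤ s`, `4 ≤ L`; nonnegativity;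
* §3 the numeric assembly: `rowBoundA_le` — `(26244/64)·Q + (1/64)·4⁶·X⁴ ≤ klEngRsq R⁸·U³/(2^17·β²)` and `rowBoundB_le` —
  `Mm·(1869885·Q) + Ms·((285/4)·4⁶·X⁴) ≤ Mm·(klEngRsq R⁸·U¹⁸/(2⁶β²)) + Ms·(U⁴/(2^217·β¹²))` at `Q = klEngRsq R⁸U¹⁸/(2^27β²)`, `X ≤ U/(2^59β³)`;
  `graded_envelope_le` — `N·lʲ·(c₁U¹⁸/β²) + N′·(c₂U⁴/β¹²) ≤ (N·c₁ + N′·c₂)·(U³/β²)·lʲ` (`0 ≤ U ≤ 1`, `1 ≤ β`, `1 ≤ l`);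
* §4 `sizeRow_of_graded` — `a·P·lᵏ ≤ Z·U³·lᵏ/l²` once `a·P·l² ≤ Z·U³` (how the Bell rows of `…LastStepAliasArith.bellRows_graded_le` meet the bracket's `hAA_Xs`),
  and `l_sq_le` (`(4^{n_β})² ≤ β²/2^13`).

Pure real arithmetic; no definitions; nothing about the model's sizes is asserted; nothing asserts superconductivity.
References: BGM 2006 §2.3 (2.21)–(2.24), §2.4 (2.36)–(2.42) [cite: BenfattoGiulianiMastropietro2006].
-/

noncomputable section

namespace Summit.HubbardSuperconductivity.HubbardSuperconductivity.Theorems.EngineV8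

set_option linter.dupNamespace false -- summit = problem name (single-conjunct summit), D-0017

open Real Finset
open Summit.HubbardSuperconductivity.HubbardSuperconductivity.Theorems.KLRegimeSplit
open Summit.HubbardSuperconductivity.HubbardSuperconductivity.Theorems.KLProgrammeLegKernels
open scoped Nat

/-! ## §1 The alias parts -/

/-- **Alias part, channel `a`**: `2(2(1·(3ʲ·(P_a(26!)²ρ²⁶)·r^{26−j−4}·S))) ≤ (26244/64)·Q`. [cite: BenfattoGiulianiMastropietro2006, §2.3 (2.24)] -/
theorem aliasPartA_le {Pa ρ r S ε B Q : ℝ} {j : ℕ} (hj : j ≤ 4) (hPa0 : 0 ≤ Pa) (hPa : Pa ≤ 1 / 64) (hρ0 : 0 ≤ ρ) (hr0 : 0 ≤ r) (hr1 : r ≤ 1)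
    (hρr : ρ * r ≤ ε) (hρB : ρ ≤ B) (hS0 : 0 ≤ S) (hS : S ≤ 81) (hQ : ((26 ! : ℝ)) ^ 2 * B ^ 8 * ε ^ 18 ≤ Q) :
    2 * (2 * (1 * ((3 : ℝ) ^ j * (Pa * ((26 ! : ℝ)) ^ 2 * ρ ^ 26) * r ^ (26 - j - 4) * S))) ≤ 26244 / 64 * Q := by
  have h3 : (3 : ℝ) ^ j ≤ 81 := by
    calc (3 : ℝ) ^ j ≤ 3 ^ 4 := pow_le_pow_right₀ (by norm_num) hj
      _ = 81 := by norm_num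
  have hB0 : 0 ≤ B := hρ0.trans hρB
  have hε0 : 0 ≤ ε := (mul_nonneg hρ0 hr0).trans hρr
  have hT := aliasTerm26_le hPa0 hρ0 hr0 hr1 hρr hρB hj
  have hQ0 : 0 ≤ ((26 ! : ℝ)) ^ 2 * B ^ 8 * ε ^ 18 := by positivity
  have hPQ : Pa * ((26 ! : ℝ)) ^ 2 * B ^ 8 * ε ^ 18 ≤ 1 / 64 * Q := by
    calc Pa * ((26 ! : ℝ)) ^ 2 * B ^ 8 * ε ^ 18 = Pa * (((26 ! : ℝ)) ^ 2 * B ^ 8 * ε ^ 18) := by ring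
      _ ≤ 1 / 64 * Q := mul_le_mul hPa hQ hQ0 (by norm_num)
  have hX0 : 0 ≤ Pa * ((26 ! : ℝ)) ^ 2 * ρ ^ 26 * r ^ (26 - j - 4) := by positivity
  have h81 : (3 : ℝ) ^ j * S ≤ 81 * 81 := mul_le_mul h3 hS hS0 (by norm_num)
  have hm := mul_le_mul h81 (hT.trans hPQ) hX0 (by norm_num)
  calc 2 * (2 * (1 * ((3 : ℝ) ^ j * (Pa * ((26 ! : ℝ)) ^ 2 * ρ ^ 26) * r ^ (26 - j - 4) * S)))
      = 4 * (((3 : ℝ) ^ j * S) * (Pa * ((26 ! : ℝ)) ^ 2 * ρ ^ 26 * r ^ (26 - j - 4))) := by ring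
    _ ≤ 4 * ((81 * 81) * (1 / 64 * Q)) := by linarith
    _ = 26244 / 64 * Q := by ring

/-- `0 ≤` the channel-`a` alias part. -/
theorem aliasPartA_nonneg {Pa ρ r S : ℝ} (j : ℕ) (hPa0 : 0 ≤ Pa) (hr0 : 0 ≤ r) (hS0 : 0 ≤ S) :
    0 ≤ 2 * (2 * (1 * ((3 : ℝ) ^ j * (Pa * ((26 ! : ℝ)) ^ 2 * ρ ^ 26) * r ^ (26 - j - 4) * S))) := by positivity

/-- **Alias part, channels `b`/`c`**: `2(2(Mm·(3ʲ·(P²(26!)²ρ₄²⁶ + 2(P(26!)²ρ₃²⁶))·r^{26−j−4}·S))) ≤ Mm·(1869885·Q)`.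
[cite: BenfattoGiulianiMastropietro2006, §2.3 (2.24)] -/
theorem aliasPartB_le {P ρ₃ ρ₄ r S ε B Q Mm : ℝ} {j : ℕ} (hj : j ≤ 4) (hP0 : 0 ≤ P) (hP : P ≤ 15 / 2) (hρ30 : 0 ≤ ρ₃) (hρ40 : 0 ≤ ρ₄)
    (hr0 : 0 ≤ r) (hr1 : r ≤ 1) (hρ3r : ρ₃ * r ≤ ε) (hρ3B : ρ₃ ≤ B) (hρ4r : ρ₄ * r ≤ ε) (hρ4B : ρ₄ ≤ B) (hS0 : 0 ≤ S) (hS : S ≤ 81)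
    (hQ : ((26 ! : ℝ)) ^ 2 * B ^ 8 * ε ^ 18 ≤ Q) (hMm : 0 ≤ Mm) :
    2 * (2 * (Mm * ((3 : ℝ) ^ j * (P * P * ((26 ! : ℝ)) ^ 2 * ρ₄ ^ 26 + 2 * (P * ((26 ! : ℝ)) ^ 2 * ρ₃ ^ 26)) * r ^ (26 - j - 4) * S))) ≤
      Mm * (1869885 * Q) := by
  have h3 : (3 : ℝ) ^ j ≤ 81 := by
    calc (3 : ℝ) ^ j ≤ 3 ^ 4 := pow_le_pow_right₀ (by norm_num) hj
      _ = 81 := by norm_num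
  have hB0 : 0 ≤ B := hρ30.trans hρ3B
  have hε0 : 0 ≤ ε := (mul_nonneg hρ30 hr0).trans hρ3r
  have hT4 := aliasTerm26_le (mul_nonneg hP0 hP0) hρ40 hr0 hr1 hρ4r hρ4B hj
  have hT3 := aliasTerm26_le hP0 hρ30 hr0 hr1 hρ3r hρ3B hj
  have hQ0 : 0 ≤ ((26 ! : ℝ)) ^ 2 * B ^ 8 * ε ^ 18 := by positivity
  have hPP : P * P + 2 * P ≤ 285 / 4 := by nlinarith
  have hD : (P * P * ((26 ! : ℝ)) ^ 2 * ρ₄ ^ 26 + 2 * (P * ((26 ! : ℝ)) ^ 2 * ρ₃ ^ 26)) * r ^ (26 - j - 4) ≤ 285 / 4 * Q := by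
    calc (P * P * ((26 ! : ℝ)) ^ 2 * ρ₄ ^ 26 + 2 * (P * ((26 ! : ℝ)) ^ 2 * ρ₃ ^ 26)) * r ^ (26 - j - 4)
        = P * P * ((26 ! : ℝ)) ^ 2 * ρ₄ ^ 26 * r ^ (26 - j - 4) + 2 * (P * ((26 ! : ℝ)) ^ 2 * ρ₃ ^ 26 * r ^ (26 - j - 4)) := by ring
      _ ≤ P * P * ((26 ! : ℝ)) ^ 2 * B ^ 8 * ε ^ 18 + 2 * (P * ((26 ! : ℝ)) ^ 2 * B ^ 8 * ε ^ 18) := by linarith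
      _ = (P * P + 2 * P) * (((26 ! : ℝ)) ^ 2 * B ^ 8 * ε ^ 18) := by ring
      _ ≤ 285 / 4 * Q := mul_le_mul hPP hQ hQ0 (by norm_num)
  have hD0 : 0 ≤ (P * P * ((26 ! : ℝ)) ^ 2 * ρ₄ ^ 26 + 2 * (P * ((26 ! : ℝ)) ^ 2 * ρ₃ ^ 26)) * r ^ (26 - j - 4) := by positivity
  have h81 : (3 : ℝ) ^ j * S ≤ 81 * 81 := mul_le_mul h3 hS hS0 (by norm_num)
  have hm := mul_le_mul h81 hD hD0 (by norm_num)
  have hm0 : 0 ≤ ((3 : ℝ) ^ j * S) * ((P * P * ((26 ! : ℝ)) ^ 2 * ρ₄ ^ 26 + 2 * (P * ((26 ! : ℝ)) ^ 2 * ρ₃ ^ 26)) * r ^ (26 - j - 4)) := by positivity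
  calc 2 * (2 * (Mm * ((3 : ℝ) ^ j * (P * P * ((26 ! : ℝ)) ^ 2 * ρ₄ ^ 26 + 2 * (P * ((26 ! : ℝ)) ^ 2 * ρ₃ ^ 26)) * r ^ (26 - j - 4) * S)))
      = 4 * Mm * (((3 : ℝ) ^ j * S) * ((P * P * ((26 ! : ℝ)) ^ 2 * ρ₄ ^ 26 + 2 * (P * ((26 ! : ℝ)) ^ 2 * ρ₃ ^ 26)) * r ^ (26 - j - 4))) := by ring
    _ ≤ 4 * Mm * ((81 * 81) * (285 / 4 * Q)) := mul_le_mul_of_nonneg_left hm (by positivity)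
    _ = Mm * (1869885 * Q) := by ring

/-- `0 ≤` the channel-`b`/`c` alias part. -/
theorem aliasPartB_nonneg {P ρ₃ ρ₄ r S Mm : ℝ} (j : ℕ) (hP0 : 0 ≤ P) (hr0 : 0 ≤ r) (hS0 : 0 ≤ S) (hMm : 0 ≤ Mm) :
    0 ≤ 2 * (2 * (Mm * ((3 : ℝ) ^ j * (P * P * ((26 ! : ℝ)) ^ 2 * ρ₄ ^ 26 + 2 * (P * ((26 ! : ℝ)) ^ 2 * ρ₃ ^ 26)) * r ^ (26 - j - 4) * S))) := by
  positivity

/-! ## §2 The far parts -/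

/-- **Far part, channel `a`**: `L²Lʲ·((P_a·(0!)²·ρ⁰)·(1/(1+L/4)^s)) ≤ (1/64)·4⁶·X⁴` for `4/L ≤ X`, `10 ≤ s`, `4 ≤ L`. [cite: BenfattoGiulianiMastropietro2006, §2.3 (2.24)] -/
theorem farPartA_le {L : ℕ} (hL4 : 4 ≤ L) {Pa ρ X : ℝ} (hPa0 : 0 ≤ Pa) (hPa : Pa ≤ 1 / 64) {j s : ℕ} (hj : j ≤ 4) (hs : 10 ≤ s)
    (h4L : 4 / (L : ℝ) ≤ X) :
    (L : ℝ) ^ 2 * (L : ℝ) ^ j * ((Pa * ((0 ! : ℝ)) ^ 2 * ρ ^ 0) * (1 / (1 + (L : ℝ) / 4) ^ s)) ≤ 1 / 64 * 4 ^ 6 * X ^ 4 := by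
  have hLr : (4 : ℝ) ≤ L := by exact_mod_cast hL4
  have hLpos : (0 : ℝ) < L := by linarith
  have hq1 : 4 / (L : ℝ) ≤ 1 := by rw [div_le_one hLpos]; exact hLr
  have hq0 : 0 ≤ 4 / (L : ℝ) := by positivity
  have hA : Pa * ((0 ! : ℝ)) ^ 2 * ρ ^ 0 = Pa := by simp [Nat.factorial]
  rw [hA]
  have h := far_weight_le hL4 hPa0 zero_le_one hj (show 6 ≤ s by omega) (Mo := 1)
  have hpow : (4 / (L : ℝ)) ^ (s - 6) ≤ X ^ 4 :=
    (pow_le_pow_of_le_one hq0 hq1 (show 4 ≤ s - 6 by omega)).trans (pow_le_pow_left₀ hq0 h4L 4)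
  calc (L : ℝ) ^ 2 * (L : ℝ) ^ j * (Pa * (1 / (1 + (L : ℝ) / 4) ^ s)) ≤ Pa * 1 * 4 ^ 6 * (4 / (L : ℝ)) ^ (s - 6) := h
    _ ≤ 1 / 64 * 1 * 4 ^ 6 * X ^ 4 := mul_le_mul (by nlinarith) hpow (by positivity) (by positivity)
    _ = 1 / 64 * 4 ^ 6 * X ^ 4 := by ring

/-- `0 ≤` the channel-`a` far part. -/
theorem farPartA_nonneg (L : ℕ) {Pa ρ : ℝ} (hPa0 : 0 ≤ Pa) (j s : ℕ) :
    0 ≤ (L : ℝ) ^ 2 * (L : ℝ) ^ j * ((Pa * ((0 ! : ℝ)) ^ 2 * ρ ^ 0) * (1 / (1 + (L : ℝ) / 4) ^ s)) := by positivity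

/-- **Far part, channels `b`/`c`**: `L²Lʲ·((P²(0!)²ρ₄⁰ + 2(P(0!)²ρ₃⁰))·(Ms/(1+L/4)^s)) ≤ Ms·((285/4)·4⁶·X⁴)`. [cite: BenfattoGiulianiMastropietro2006, §2.3 (2.24)] -/
theorem farPartB_le {L : ℕ} (hL4 : 4 ≤ L) {P ρ₃ ρ₄ X Ms : ℝ} (hP0 : 0 ≤ P) (hP : P ≤ 15 / 2) (hMs : 0 ≤ Ms) {j s : ℕ} (hj : j ≤ 4) (hs : 10 ≤ s)
    (h4L : 4 / (L : ℝ) ≤ X) :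
    (L : ℝ) ^ 2 * (L : ℝ) ^ j * ((P * P * ((0 ! : ℝ)) ^ 2 * ρ₄ ^ 0 + 2 * (P * ((0 ! : ℝ)) ^ 2 * ρ₃ ^ 0)) * (Ms / (1 + (L : ℝ) / 4) ^ s)) ≤
      Ms * (285 / 4 * 4 ^ 6 * X ^ 4) := by
  have hLr : (4 : ℝ) ≤ L := by exact_mod_cast hL4
  have hLpos : (0 : ℝ) < L := by linarith
  have hq1 : 4 / (L : ℝ) ≤ 1 := by rw [div_le_one hLpos]; exact hLr
  have hq0 : 0 ≤ 4 / (L : ℝ) := by positivity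
  have hA : P * P * ((0 ! : ℝ)) ^ 2 * ρ₄ ^ 0 + 2 * (P * ((0 ! : ℝ)) ^ 2 * ρ₃ ^ 0) = P * P + 2 * P := by simp [Nat.factorial]
  rw [hA]
  have hPP0 : 0 ≤ P * P + 2 * P := by positivity
  have hPP : P * P + 2 * P ≤ 285 / 4 := by nlinarith
  have h := far_weight_le hL4 hPP0 hMs hj (show 6 ≤ s by omega)
  have hpow : (4 / (L : ℝ)) ^ (s - 6) ≤ X ^ 4 :=
    (pow_le_pow_of_le_one hq0 hq1 (show 4 ≤ s - 6 by omega)).trans (pow_le_pow_left₀ hq0 h4L 4)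
  calc (L : ℝ) ^ 2 * (L : ℝ) ^ j * ((P * P + 2 * P) * (Ms / (1 + (L : ℝ) / 4) ^ s)) ≤ (P * P + 2 * P) * Ms * 4 ^ 6 * (4 / (L : ℝ)) ^ (s - 6) := h
    _ ≤ 285 / 4 * Ms * 4 ^ 6 * X ^ 4 := mul_le_mul (by nlinarith) hpow (by positivity) (by positivity)
    _ = Ms * (285 / 4 * 4 ^ 6 * X ^ 4) := by ring

/-- `0 ≤` the channel-`b`/`c` far part. -/
theorem farPartB_nonneg (L : ℕ) {P ρ₃ ρ₄ Ms : ℝ} (hP0 : 0 ≤ P) (hMs : 0 ≤ Ms) (j s : ℕ) :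
    0 ≤ (L : ℝ) ^ 2 * (L : ℝ) ^ j * ((P * P * ((0 ! : ℝ)) ^ 2 * ρ₄ ^ 0 + 2 * (P * ((0 ! : ℝ)) ^ 2 * ρ₃ ^ 0)) * (Ms / (1 + (L : ℝ) / 4) ^ s)) := by
  positivity

/-! ## §3 The numeric assembly -/

/-- **Row bound, channel `a`**: `(26244/64)·Q + (1/64)·4⁶·X⁴ ≤ Rsq⁸·U³/(2^17·β²)` at `Q = Rsq⁸U¹⁸/(2^27β²)`, `0 ≤ X ≤ U/(2^59β³)`, `0 ≤ U ≤ 1`, `128 ≤ β`, `1 ≤ Rsq`.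
[cite: BenfattoGiulianiMastropietro2006, §2.3 (2.24)] -/
theorem rowBoundA_le {Rsq U β X : ℝ} (hRsq : 1 ≤ Rsq) (hU0 : 0 ≤ U) (hU1 : U ≤ 1) (hβ : 128 ≤ β) (hX0 : 0 ≤ X) (hX : X ≤ U / (2 ^ 59 * β ^ 3)) :
    26244 / 64 * (Rsq ^ 8 * U ^ 18 / (2 ^ 27 * β ^ 2)) + 1 / 64 * 4 ^ 6 * X ^ 4 ≤ Rsq ^ 8 * U ^ 3 / (2 ^ 17 * β ^ 2) := by
  have hβ0 : 0 < β := by linarith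
  have hβ1 : 1 ≤ β := by linarith
  have hR8 : 1 ≤ Rsq ^ 8 := one_le_pow₀ hRsq
  have hU18 : U ^ 18 ≤ U ^ 3 := pow_le_pow_of_le_one hU0 hU1 (by norm_num)
  have hU4 : U ^ 4 ≤ U ^ 3 := pow_le_pow_of_le_one hU0 hU1 (by norm_num)
  have hX4 : X ^ 4 ≤ (U / (2 ^ 59 * β ^ 3)) ^ 4 := pow_le_pow_left₀ hX0 hX 4
  have hb : (U / (2 ^ 59 * β ^ 3)) ^ 4 = U ^ 4 / (2 ^ 236 * β ^ 12) := by rw [div_pow, mul_pow]; ring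
  have hβ12 : β ^ 2 ≤ β ^ 12 := pow_le_pow_right₀ hβ1 (by norm_num)
  have hβ2 : 0 < β ^ 2 := by positivity
  -- the far term against `U³/β²`
  have hfar : 1 / 64 * 4 ^ 6 * X ^ 4 ≤ (2 ^ 6 / 2 ^ 236) * (U ^ 3 / β ^ 2) := by
    have h1 : U ^ 4 / (2 ^ 236 * β ^ 12) ≤ U ^ 3 / (2 ^ 236 * β ^ 2) := by
      rw [div_le_div_iff₀ (by positivity) (by positivity)]
      have := mul_le_mul hU4 (mul_le_mul_of_nonneg_left hβ12 (by norm_num : (0 : ℝ) ≤ 2 ^ 236)) (by positivity) (by positivity)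
      linarith
    calc 1 / 64 * 4 ^ 6 * X ^ 4 ≤ 1 / 64 * 4 ^ 6 * (U ^ 4 / (2 ^ 236 * β ^ 12)) := by rw [← hb]; gcongr
      _ ≤ 1 / 64 * 4 ^ 6 * (U ^ 3 / (2 ^ 236 * β ^ 2)) := by gcongr
      _ = (2 ^ 6 / 2 ^ 236) * (U ^ 3 / β ^ 2) := by field_simp; ring
  -- the alias term against `Rsq⁸·U³/β²`
  have halias : 26244 / 64 * (Rsq ^ 8 * U ^ 18 / (2 ^ 27 * β ^ 2)) ≤ (26244 / 64 / 2 ^ 27) * (Rsq ^ 8 * (U ^ 3 / β ^ 2)) := by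
    have h1 : Rsq ^ 8 * U ^ 18 / (2 ^ 27 * β ^ 2) = (1 / 2 ^ 27) * (Rsq ^ 8 * (U ^ 18 / β ^ 2)) := by field_simp
    rw [h1]
    have h2 : U ^ 18 / β ^ 2 ≤ U ^ 3 / β ^ 2 := div_le_div_of_nonneg_right hU18 hβ2.le
    nlinarith [mul_le_mul_of_nonneg_left h2 (zero_le_one.trans hR8)]
  have hgoal : (26244 / 64 / 2 ^ 27) * (Rsq ^ 8 * (U ^ 3 / β ^ 2)) + (2 ^ 6 / 2 ^ 236) * (U ^ 3 / β ^ 2) ≤ Rsq ^ 8 * U ^ 3 / (2 ^ 17 * β ^ 2) := by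
    have h3 : Rsq ^ 8 * U ^ 3 / (2 ^ 17 * β ^ 2) = (1 / 2 ^ 17) * (Rsq ^ 8 * (U ^ 3 / β ^ 2)) := by field_simp
    rw [h3]
    have hV0 : 0 ≤ U ^ 3 / β ^ 2 := by positivity
    have hV : U ^ 3 / β ^ 2 ≤ Rsq ^ 8 * (U ^ 3 / β ^ 2) := le_mul_of_one_le_left hV0 hR8
    nlinarith
  linarith

/-- **Row bound, channels `b`/`c`**: `Mm·(1869885·Q) + Ms·((285/4)·4⁶·X⁴) ≤ Mm·(Rsq⁸U¹⁸/(2⁶β²)) + Ms·(U⁴/(2^217β¹²))`.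
[cite: BenfattoGiulianiMastropietro2006, §2.3 (2.24)] -/
theorem rowBoundB_le {Rsq U β X Mm Ms : ℝ} (hβ : 128 ≤ β) (hX0 : 0 ≤ X) (hX : X ≤ U / (2 ^ 59 * β ^ 3))
    (hMm : 0 ≤ Mm) (hMs : 0 ≤ Ms) :
    Mm * (1869885 * (Rsq ^ 8 * U ^ 18 / (2 ^ 27 * β ^ 2))) + Ms * (285 / 4 * 4 ^ 6 * X ^ 4) ≤
      Mm * (Rsq ^ 8 * U ^ 18 / (2 ^ 6 * β ^ 2)) + Ms * (U ^ 4 / (2 ^ 217 * β ^ 12)) := by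
  have hβ0 : 0 < β := by linarith
  have hX4 : X ^ 4 ≤ (U / (2 ^ 59 * β ^ 3)) ^ 4 := pow_le_pow_left₀ hX0 hX 4
  have hb : (U / (2 ^ 59 * β ^ 3)) ^ 4 = U ^ 4 / (2 ^ 236 * β ^ 12) := by rw [div_pow, mul_pow]; ring
  have h1 : 1869885 * (Rsq ^ 8 * U ^ 18 / (2 ^ 27 * β ^ 2)) ≤ Rsq ^ 8 * U ^ 18 / (2 ^ 6 * β ^ 2) := by
    rw [mul_div_assoc', div_le_div_iff₀ (by positivity) (by positivity)]
    have : 0 ≤ Rsq ^ 8 * U ^ 18 * β ^ 2 := by positivity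
    nlinarith
  have h2 : 285 / 4 * 4 ^ 6 * X ^ 4 ≤ U ^ 4 / (2 ^ 217 * β ^ 12) := by
    calc 285 / 4 * 4 ^ 6 * X ^ 4 ≤ 285 / 4 * 4 ^ 6 * (U ^ 4 / (2 ^ 236 * β ^ 12)) := by rw [← hb]; gcongr
      _ ≤ U ^ 4 / (2 ^ 217 * β ^ 12) := by
          rw [mul_div_assoc', div_le_div_iff₀ (by positivity) (by positivity)]
          have : 0 ≤ U ^ 4 * β ^ 12 := by positivity
          nlinarith
  have := mul_le_mul_of_nonneg_left h1 hMm
  have := mul_le_mul_of_nonneg_left h2 hMs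
  linarith

/-- **Graded envelope**: `(N·lʲ)·(c₁) + N′·(c₂) ≤ (N·c₁' + N′·c₂')·V·lʲ` in the concrete shape used by the rows:
`Mm·(Rsq⁸U¹⁸/(2⁶β²)) + Ms·(U⁴/(2^217β¹²)) ≤ (N·Rsq⁸/2⁶ + N′/2^217)·(U³/β²)·lʲ` for `Mm ≤ N·lʲ`, `Ms ≤ N′`, `0 ≤ U ≤ 1`, `128 ≤ β`, `1 ≤ l`.
[cite: BenfattoGiulianiMastropietro2006, §2.3 (2.24)] -/
theorem graded_envelope_le {Rsq U β l Mm Ms N N' : ℝ} {j : ℕ} (hU0 : 0 ≤ U) (hU1 : U ≤ 1) (hβ : 128 ≤ β) (hl : 1 ≤ l)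
    (hMm0 : 0 ≤ Mm) (hMs0 : 0 ≤ Ms) (hMm : Mm ≤ N * l ^ j) (hMs : Ms ≤ N') :
    Mm * (Rsq ^ 8 * U ^ 18 / (2 ^ 6 * β ^ 2)) + Ms * (U ^ 4 / (2 ^ 217 * β ^ 12)) ≤ (N * Rsq ^ 8 / 2 ^ 6 + N' / 2 ^ 217) * (U ^ 3 / β ^ 2) * l ^ j := by
  have hβ0 : 0 < β := by linarith
  have hβ1 : 1 ≤ β := by linarith
  have hlj : 1 ≤ l ^ j := one_le_pow₀ hl
  have hU18 : U ^ 18 ≤ U ^ 3 := pow_le_pow_of_le_one hU0 hU1 (by norm_num)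
  have hU4 : U ^ 4 ≤ U ^ 3 := pow_le_pow_of_le_one hU0 hU1 (by norm_num)
  have hV0 : 0 ≤ U ^ 3 / β ^ 2 := by positivity
  have hA : Rsq ^ 8 * U ^ 18 / (2 ^ 6 * β ^ 2) ≤ Rsq ^ 8 / 2 ^ 6 * (U ^ 3 / β ^ 2) := by
    rw [div_le_iff₀ (by positivity)]
    have e : Rsq ^ 8 / 2 ^ 6 * (U ^ 3 / β ^ 2) * (2 ^ 6 * β ^ 2) = Rsq ^ 8 * U ^ 3 := by field_simp
    rw [e]
    exact mul_le_mul_of_nonneg_left hU18 (by positivity)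
  have hA0 : 0 ≤ Rsq ^ 8 * U ^ 18 / (2 ^ 6 * β ^ 2) := by positivity
  have hB : U ^ 4 / (2 ^ 217 * β ^ 12) ≤ 1 / 2 ^ 217 * (U ^ 3 / β ^ 2) := by
    rw [div_le_iff₀ (by positivity)]
    have e : 1 / 2 ^ 217 * (U ^ 3 / β ^ 2) * (2 ^ 217 * β ^ 12) = U ^ 3 * β ^ 10 := by field_simp
    rw [e]
    calc U ^ 4 = U ^ 4 * 1 := (mul_one _).symm
      _ ≤ U ^ 3 * β ^ 10 := mul_le_mul hU4 (one_le_pow₀ hβ1) zero_le_one (by positivity)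
  have hB0 : 0 ≤ U ^ 4 / (2 ^ 217 * β ^ 12) := by positivity
  have hN0 : 0 ≤ N * l ^ j := hMm0.trans hMm
  have hN'0 : 0 ≤ N' := hMs0.trans hMs
  have h1 : Mm * (Rsq ^ 8 * U ^ 18 / (2 ^ 6 * β ^ 2)) ≤ (N * l ^ j) * (Rsq ^ 8 / 2 ^ 6 * (U ^ 3 / β ^ 2)) := mul_le_mul hMm hA hA0 hN0
  have h2 : Ms * (U ^ 4 / (2 ^ 217 * β ^ 12)) ≤ N' * (1 / 2 ^ 217 * (U ^ 3 / β ^ 2)) := mul_le_mul hMs hB hB0 hN'0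
  have h3 : N' * (1 / 2 ^ 217 * (U ^ 3 / β ^ 2)) ≤ N' * (1 / 2 ^ 217 * (U ^ 3 / β ^ 2)) * l ^ j :=
    le_mul_of_one_le_right (by positivity) hlj
  calc Mm * (Rsq ^ 8 * U ^ 18 / (2 ^ 6 * β ^ 2)) + Ms * (U ^ 4 / (2 ^ 217 * β ^ 12))
      ≤ (N * l ^ j) * (Rsq ^ 8 / 2 ^ 6 * (U ^ 3 / β ^ 2)) + N' * (1 / 2 ^ 217 * (U ^ 3 / β ^ 2)) * l ^ j := by linarith
    _ = (N * Rsq ^ 8 / 2 ^ 6 + N' / 2 ^ 217) * (U ^ 3 / β ^ 2) * l ^ j := by ring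

/-! ## §4 From graded Bell rows to the bracket's size rows -/

/-- **The size row from a graded Bell row**: if `a·P·l² ≤ Z·U³` then `a·P·lᵏ ≤ Z·U³·lᵏ/l²` (`0 < l`). [cite: BenfattoGiulianiMastropietro2006, §2.4 (2.36)] -/
theorem sizeRow_of_graded {a P l Z U : ℝ} (hl : 0 < l) (h : a * P * l ^ 2 ≤ Z * U ^ 3) (k : ℕ) :
    a * P * l ^ k ≤ Z * U ^ 3 * l ^ k / l ^ 2 := by
  rw [le_div_iff₀ (by positivity)]
  calc a * P * l ^ k * l ^ 2 = (a * P * l ^ 2) * l ^ k := by ring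
    _ ≤ (Z * U ^ 3) * l ^ k := mul_le_mul_of_nonneg_right h (by positivity)

/-- **`(4^{n_β})² ≤ β²/2^13`** (`16^{n_β} ≤ β²/(1024π²)`, `π² ≥ 8`). [cite: BenfattoGiulianiMastropietro2006, §2.3 (2.21)] -/
theorem l_sq_le {β : ℝ} (hβ : klBetaMin ≤ β) : ((4 : ℝ) ^ nScales β) ^ 2 ≤ β ^ 2 / 2 ^ 13 := by
  have h := sixteen_pow_nScales_le hβ
  have h16 : ((4 : ℝ) ^ nScales β) ^ 2 = (16 : ℝ) ^ nScales β := by rw [← pow_mul, mul_comm, pow_mul]; norm_num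
  have hπ : (8 : ℝ) ≤ π ^ 2 := by nlinarith [Real.pi_gt_three]
  rw [h16]
  refine h.trans ?_
  rw [div_le_div_iff₀ (by positivity) (by positivity)]
  nlinarith [sq_nonneg β]

/-- **The channel constant meets `ZA`**: `(c·U³/β²)·P·l² ≤ (c·P/2^13)·U³` for `l = 4^{n_β}`, `0 ≤ c`, `0 ≤ P`.
[cite: BenfattoGiulianiMastropietro2006, §2.4 (2.36)] -/
theorem channelConst_le {β c P U : ℝ} (hβ : klBetaMin ≤ β) (hc : 0 ≤ c) (hP : 0 ≤ P) (hU : 0 ≤ U) :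
    (c * (U ^ 3 / β ^ 2)) * P * ((4 : ℝ) ^ nScales β) ^ 2 ≤ (c * P / 2 ^ 13) * U ^ 3 := by
  have h128 : (128 : ℝ) ≤ β := by simpa [klBetaMin] using hβ
  have hβ2 : 0 < β ^ 2 := by positivity
  have hl := l_sq_le hβ
  calc (c * (U ^ 3 / β ^ 2)) * P * ((4 : ℝ) ^ nScales β) ^ 2 ≤ (c * (U ^ 3 / β ^ 2)) * P * (β ^ 2 / 2 ^ 13) :=
        mul_le_mul_of_nonneg_left hl (by positivity)
    _ = (c * P / 2 ^ 13) * U ^ 3 := by field_simp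

end Summit.HubbardSuperconductivity.HubbardSuperconductivity.Theorems.EngineV8

end
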